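import Mathlib
import HarnessLib
import Summits.ValiantsHypothesis.ValiantsHypothesis.Theorems.KPlusLogSqLawMixedGaugeBlockFamily

/-!
# Route «KPlusLogSqLaw», `WeakLifting` (stmt-ValiantsHypothesis-19561) — mixed-gauge series, next shape: THE VERTEX-GAUGE BLOCK FAMILY WITH
# SEVERAL SLOW SPEEDS `x ↦ [[A + diag(x^{a₁},…,x^{aₙ}), B], [Bᵀ, C − x^b·1]]` — two-point identity, first-order form, end scales

HONEST FRAMING.  Helper file (hand leafhand-val-kpluslogsqlaw-1 g14, 2026-08-31; `--supports stmt-ValiantsHypothesis-19561 --as helper`,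
zero crux / stub credit).  The diagonal-letter analogue of `…MixedGaugeBlockFamily` (p834162) for the next shape of lift-p4 g26's GAP
NOTE (ii): `n` slow positive diagonal monomials with ARBITRARY individual speeds `aᵢ ≥ 1`, `m` fast negative ones of speed `b`, one
constant symmetric letter.  Content: the COORDINATEWISE block two-point identity `Σᵢ (Dᵢ' − Dᵢ) wᵢwᵢ' = (t' − t)⟪q,q'⟫`
(`coord_two_point_blocks`, symmetry of `A` and `C`, any `B`); symmetry / continuity of the family; the first-order form
`F x = F t + (x − t)·G_t x` with `G_t x = [[diag(g_{aᵢ}(x,t)), 0], [0, −g_b(x,t)·1]]` (geometric sums); the kernel form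
`uᵀG_t(t)u = Σᵢ aᵢ t^{aᵢ−1} wᵢ² − b t^{b−1}‖q‖²` (`form_coordDiagBlocks`); and the END SCALES (`coordFamily_det_ne_zero_of_large`,
`coordFamily_negIndex_ge_of_large`).  Nothing here is about `WeakLifting` / `TropicalB` in their windows, the registered stubs, the doors,
`MatrixDescartes` (18050) or VP ≠ VNP.  No `def`; axioms standard. [folklore]
-/

set_option linter.dupNamespace false
set_option autoImplicit false

namespace Summit.ValiantsHypothesis.ValiantsHypothesis.Theorems.KPlusLogSqLaw

namespace MixedGauge

open Matrix Finset Polynomial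
open scoped BigOperators Topology
open Summit.ValiantsHypothesis.ValiantsHypothesis.Theorems.LacunarySymmetroidMatrixDescartes
open Summit.ValiantsHypothesis.ValiantsHypothesis.Theorems.LacunarySymmetroidMatrixDescartes.Inertia

variable {n m : ℕ}

/-! ## 1. The coordinatewise two-point identity and the kernel form -/

/-- **Coordinatewise block two-point identity.**  `A`, `C` real symmetric, `B` arbitrary: if `(A + diag D) w + B q = 0`,
`Bᵀ w + (C − t·1) q = 0` and the same for `(w', q')` at `(D', t')`, then `Σᵢ (Dᵢ' − Dᵢ)·wᵢwᵢ' = (t' − t)·⟪q,q'⟫`. [folklore] -/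
theorem coord_two_point_blocks (A : Matrix (Fin n) (Fin n) ℝ) (hA : A.IsSymm) (C : Matrix (Fin m) (Fin m) ℝ) (hC : C.IsSymm)
    (B : Matrix (Fin n) (Fin m) ℝ) (D D' : Fin n → ℝ) (t t' : ℝ) (w w' : Fin n → ℝ) (q q' : Fin m → ℝ)
    (h1 : (A + Matrix.diagonal D) *ᵥ w + B *ᵥ q = 0)
    (h2 : Bᵀ *ᵥ w + (C - t • (1 : Matrix (Fin m) (Fin m) ℝ)) *ᵥ q = 0)
    (h1' : (A + Matrix.diagonal D') *ᵥ w' + B *ᵥ q' = 0)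
    (h2' : Bᵀ *ᵥ w' + (C - t' • (1 : Matrix (Fin m) (Fin m) ℝ)) *ᵥ q' = 0) :
    ∑ i, (D' i - D i) * (w i * w' i) = (t' - t) * (q ⬝ᵥ q') := by
  have e1 : w' ⬝ᵥ ((A + Matrix.diagonal D) *ᵥ w + B *ᵥ q) = 0 := by rw [h1, dotProduct_zero]
  have e1' : w ⬝ᵥ ((A + Matrix.diagonal D') *ᵥ w' + B *ᵥ q') = 0 := by rw [h1', dotProduct_zero]
  have e2 : q' ⬝ᵥ (Bᵀ *ᵥ w + (C - t • (1 : Matrix (Fin m) (Fin m) ℝ)) *ᵥ q) = 0 := by rw [h2, dotProduct_zero]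
  have e2' : q ⬝ᵥ (Bᵀ *ᵥ w' + (C - t' • (1 : Matrix (Fin m) (Fin m) ℝ)) *ᵥ q') = 0 := by rw [h2', dotProduct_zero]
  have hAs : w' ⬝ᵥ (A *ᵥ w) = w ⬝ᵥ (A *ᵥ w') := by
    rw [Matrix.dotProduct_mulVec, ← Matrix.mulVec_transpose, hA, dotProduct_comm]
  have hCs : q' ⬝ᵥ (C *ᵥ q) = q ⬝ᵥ (C *ᵥ q') := by
    rw [Matrix.dotProduct_mulVec, ← Matrix.mulVec_transpose, hC, dotProduct_comm]
  have hB1 : w' ⬝ᵥ (B *ᵥ q) = q ⬝ᵥ (Bᵀ *ᵥ w') := by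
    rw [Matrix.dotProduct_mulVec, ← Matrix.mulVec_transpose, dotProduct_comm]
  have hB2 : w ⬝ᵥ (B *ᵥ q') = q' ⬝ᵥ (Bᵀ *ᵥ w) := by
    rw [Matrix.dotProduct_mulVec, ← Matrix.mulVec_transpose, dotProduct_comm]
  have hD : w' ⬝ᵥ (Matrix.diagonal D *ᵥ w) = ∑ i, D i * (w i * w' i) := by
    rw [dotProduct]; refine Finset.sum_congr rfl fun i _ => ?_; rw [Matrix.mulVec_diagonal]; ring
  have hD' : w ⬝ᵥ (Matrix.diagonal D' *ᵥ w') = ∑ i, D' i * (w i * w' i) := by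
    rw [dotProduct]; refine Finset.sum_congr rfl fun i _ => ?_; rw [Matrix.mulVec_diagonal]; ring
  rw [Matrix.add_mulVec, dotProduct_add, dotProduct_add] at e1 e1'
  rw [Matrix.sub_mulVec, dotProduct_add, dotProduct_sub, Matrix.smul_mulVec, one_mulVec, dotProduct_smul] at e2 e2'
  rw [hAs, hB1, hD] at e1
  rw [hB2, hD'] at e1'
  rw [hCs, dotProduct_comm q' q] at e2
  simp only [smul_eq_mul] at e2 e2'
  have hsum : ∑ i, (D' i - D i) * (w i * w' i) = ∑ i, D' i * (w i * w' i) - ∑ i, D i * (w i * w' i) := by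
    rw [← Finset.sum_sub_distrib]; refine Finset.sum_congr rfl fun i _ => ?_; ring
  rw [hsum]
  linear_combination e1' - e1 - e2 + e2'

/-- the form of `[[diag α, 0], [0, −β·1]]` on `(w, q)`. [folklore] -/
theorem form_coordDiagBlocks (α : Fin n → ℝ) (β : ℝ) (w : Fin n → ℝ) (q : Fin m → ℝ) :
    Sum.elim w q ⬝ᵥ (Matrix.fromBlocks (Matrix.diagonal α) 0 0 (-(β • (1 : Matrix (Fin m) (Fin m) ℝ))) *ᵥ Sum.elim w q)
      = ∑ i, α i * w i ^ 2 - β * (q ⬝ᵥ q) := by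
  rw [Matrix.fromBlocks_mulVec, Sum.elim_comp_inl, Sum.elim_comp_inr, Matrix.zero_mulVec, Matrix.zero_mulVec, add_zero,
    zero_add, Matrix.neg_mulVec, Matrix.smul_mulVec, Matrix.one_mulVec, sumElim_dotProduct_sumElim, dotProduct_neg,
    dotProduct_smul, smul_eq_mul]
  have hw : w ⬝ᵥ (Matrix.diagonal α *ᵥ w) = ∑ i, α i * w i ^ 2 := by
    rw [dotProduct]; refine Finset.sum_congr rfl fun i _ => ?_; rw [Matrix.mulVec_diagonal]; ring
  rw [hw]; ring

/-! ## 2. The family: symmetry, continuity, first-order form -/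

section Family

variable (A : Matrix (Fin n) (Fin n) ℝ) (C : Matrix (Fin m) (Fin m) ℝ) (B : Matrix (Fin n) (Fin m) ℝ) (a : Fin n → ℕ) (b : ℕ)

/-- symmetry of the coordinate-speed block family. [folklore] -/
theorem coordFamily_isSymm (hA : A.IsSymm) (hC : C.IsSymm) (x : ℝ) :
    (Matrix.fromBlocks (A + Matrix.diagonal (fun i => x ^ a i)) B Bᵀ
      (C - (x ^ b) • (1 : Matrix (Fin m) (Fin m) ℝ))).IsSymm :=
  Matrix.IsSymm.fromBlocks (hA.add (Matrix.isSymm_diagonal _)) rfl (hC.sub (Matrix.isSymm_one.smul _))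

/-- entrywise continuity of the coordinate-speed block family. [folklore] -/
theorem coordFamily_continuous (i j : Fin n ⊕ Fin m) :
    Continuous fun x : ℝ => (Matrix.fromBlocks (A + Matrix.diagonal (fun i => x ^ a i)) B Bᵀ
      (C - (x ^ b) • (1 : Matrix (Fin m) (Fin m) ℝ))) i j := by
  rcases i with i | i <;> rcases j with j | j
  · simp only [Matrix.fromBlocks_apply₁₁, Matrix.add_apply]
    by_cases hij : i = j
    · subst hij; simp only [Matrix.diagonal_apply_eq]; fun_prop
    · simp only [Matrix.diagonal_apply_ne _ hij, add_zero]; fun_prop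
  · simp only [Matrix.fromBlocks_apply₁₂]
    fun_prop
  · simp only [Matrix.fromBlocks_apply₂₁]
    fun_prop
  · simp only [Matrix.fromBlocks_apply₂₂, Matrix.sub_apply, Matrix.smul_apply, smul_eq_mul]
    fun_prop

/-- entrywise continuity of the difference-quotient family. [folklore] -/
theorem coordDiffFamily_continuous (t : ℝ) (i j : Fin n ⊕ Fin m) :
    Continuous fun x : ℝ => (Matrix.fromBlocks (Matrix.diagonal (fun i => ∑ l ∈ range (a i), x ^ l * t ^ (a i - 1 - l))) 0 0
      (-((∑ l ∈ range b, x ^ l * t ^ (b - 1 - l)) • (1 : Matrix (Fin m) (Fin m) ℝ)))) i j := by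
  rcases i with i | i <;> rcases j with j | j
  · simp only [Matrix.fromBlocks_apply₁₁]
    by_cases hij : i = j
    · subst hij; simp only [Matrix.diagonal_apply_eq]; fun_prop
    · simp only [Matrix.diagonal_apply_ne _ hij]; fun_prop
  · simp only [Matrix.fromBlocks_apply₁₂, Matrix.zero_apply]
    fun_prop
  · simp only [Matrix.fromBlocks_apply₂₁, Matrix.zero_apply]
    fun_prop
  · simp only [Matrix.fromBlocks_apply₂₂, Matrix.neg_apply, Matrix.smul_apply, smul_eq_mul]
    fun_prop

/-- the first-order form of the coordinate-speed family at `t`. [folklore] -/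
theorem coordFamily_firstOrder (t x : ℝ) :
    Matrix.fromBlocks (A + Matrix.diagonal (fun i => x ^ a i)) B Bᵀ (C - (x ^ b) • (1 : Matrix (Fin m) (Fin m) ℝ))
      = Matrix.fromBlocks (A + Matrix.diagonal (fun i => t ^ a i)) B Bᵀ (C - (t ^ b) • (1 : Matrix (Fin m) (Fin m) ℝ))
        + (x - t) • Matrix.fromBlocks (Matrix.diagonal (fun i => ∑ l ∈ range (a i), x ^ l * t ^ (a i - 1 - l))) 0 0
            (-((∑ l ∈ range b, x ^ l * t ^ (b - 1 - l)) • (1 : Matrix (Fin m) (Fin m) ℝ))) := by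
  have hga : ∀ i, x ^ a i = t ^ a i + (x - t) * ∑ l ∈ range (a i), x ^ l * t ^ (a i - 1 - l) := by
    intro i
    have := (Commute.all x t).geom_sum₂_mul (a i)
    linear_combination -this
  have hgb : x ^ b = t ^ b + (x - t) * ∑ l ∈ range b, x ^ l * t ^ (b - 1 - l) := by
    have := (Commute.all x t).geom_sum₂_mul b
    linear_combination -this
  rw [Matrix.fromBlocks_smul, Matrix.fromBlocks_add, smul_zero, smul_zero, add_zero, add_zero]
  congr 1
  · rw [add_assoc, ← Matrix.diagonal_smul, Matrix.diagonal_add]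
    congr 1
    congr 1
    funext i
    rw [hga i, Pi.smul_apply, smul_eq_mul]
  · rw [hgb, add_smul, smul_neg, smul_smul, sub_add_eq_sub_sub, sub_eq_add_neg]

/-! ## 3. The end scales -/

/-- at a large scale the coordinate-speed family is non-singular (`x ≥ 1`, `x > Σ|Aᵢⱼ|`, `x > Σ|Cᵢⱼ|`, all speeds `≥ 1`). [folklore] -/
theorem coordFamily_det_ne_zero_of_large (ha : ∀ i, 1 ≤ a i) (hb : 1 ≤ b) (x : ℝ) (hx1 : 1 ≤ x)
    (hxA : ∑ i, ∑ j, |A i j| < x) (hxC : ∑ i, ∑ j, |C i j| < x) :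
    (Matrix.fromBlocks (A + Matrix.diagonal (fun i => x ^ a i)) B Bᵀ
      (C - (x ^ b) • (1 : Matrix (Fin m) (Fin m) ℝ))).det ≠ 0 := by
  intro hdet
  obtain ⟨u, hu0, hu⟩ := Matrix.exists_mulVec_eq_zero_iff.mpr hdet
  set w : Fin n → ℝ := u ∘ Sum.inl with hw
  set q : Fin m → ℝ := u ∘ Sum.inr with hq
  have huwq : u = Sum.elim w q := by
    funext i; rcases i with i | i <;> rfl
  rw [huwq, Matrix.fromBlocks_mulVec] at hu
  have h1 : (A + Matrix.diagonal (fun i => x ^ a i)) *ᵥ w + B *ᵥ q = 0 := by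
    funext i; have := congrFun hu (Sum.inl i); simpa using this
  have h2 : Bᵀ *ᵥ w + (C - (x ^ b) • (1 : Matrix (Fin m) (Fin m) ℝ)) *ᵥ q = 0 := by
    funext i; have := congrFun hu (Sum.inr i); simpa using this
  have e1 : w ⬝ᵥ ((A + Matrix.diagonal (fun i => x ^ a i)) *ᵥ w) + w ⬝ᵥ (B *ᵥ q) = 0 := by
    rw [← dotProduct_add, h1, dotProduct_zero]
  have e2 : q ⬝ᵥ (Bᵀ *ᵥ w) + q ⬝ᵥ ((C - (x ^ b) • (1 : Matrix (Fin m) (Fin m) ℝ)) *ᵥ q) = 0 := by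
    rw [← dotProduct_add, h2, dotProduct_zero]
  have e3 : q ⬝ᵥ (Bᵀ *ᵥ w) = w ⬝ᵥ (B *ᵥ q) := by
    rw [Matrix.dotProduct_mulVec, Matrix.vecMul_transpose, dotProduct_comm]
  have hxb : x ≤ x ^ b := le_self_pow₀ hx1 (by omega)
  have hAw : w ⬝ᵥ ((A + Matrix.diagonal (fun i => x ^ a i)) *ᵥ w) = w ⬝ᵥ (A *ᵥ w) + ∑ i, x ^ a i * w i ^ 2 := by
    rw [Matrix.add_mulVec, dotProduct_add]
    congr 1
    rw [dotProduct]; refine Finset.sum_congr rfl fun i _ => ?_; rw [Matrix.mulVec_diagonal]; ring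
  have hCq : q ⬝ᵥ ((C - (x ^ b) • (1 : Matrix (Fin m) (Fin m) ℝ)) *ᵥ q) = q ⬝ᵥ (C *ᵥ q) - x ^ b * (q ⬝ᵥ q) := by
    rw [Matrix.sub_mulVec, dotProduct_sub, Matrix.smul_mulVec, Matrix.one_mulVec, dotProduct_smul, smul_eq_mul]
  have hbA' := form_le_absSum_mul (-A) w
  have hbC := form_le_absSum_mul C q
  have hnegA : ∑ i, ∑ j, |(-A) i j| = ∑ i, ∑ j, |A i j| := by simp
  rw [hnegA, Matrix.neg_mulVec, dotProduct_neg] at hbA'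
  have hww : 0 ≤ w ⬝ᵥ w := by rw [dotProduct]; exact Finset.sum_nonneg fun i _ => mul_self_nonneg _
  have hqq : 0 ≤ q ⬝ᵥ q := by rw [dotProduct]; exact Finset.sum_nonneg fun i _ => mul_self_nonneg _
  -- the diagonal piece dominates x·‖w‖²
  have hdiag : x * (w ⬝ᵥ w) ≤ ∑ i, x ^ a i * w i ^ 2 := by
    rw [dotProduct, Finset.mul_sum]
    refine Finset.sum_le_sum fun i _ => ?_
    have hxa : x ≤ x ^ a i := le_self_pow₀ hx1 (by have := ha i; omega)
    nlinarith [mul_self_nonneg (w i)]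
  have hsum : (w ⬝ᵥ (A *ᵥ w) + ∑ i, x ^ a i * w i ^ 2) + (x ^ b * (q ⬝ᵥ q) - q ⬝ᵥ (C *ᵥ q)) = 0 := by
    rw [hAw] at e1; rw [hCq, e3] at e2; linarith
  have hcA : 0 < x - ∑ i, ∑ j, |A i j| := by linarith
  have hcC : 0 < x ^ b - ∑ i, ∑ j, |C i j| := by linarith
  have hp1 : 0 ≤ w ⬝ᵥ (A *ᵥ w) + ∑ i, x ^ a i * w i ^ 2 := by nlinarith [mul_nonneg hcA.le hww]
  have hp2 : 0 ≤ x ^ b * (q ⬝ᵥ q) - q ⬝ᵥ (C *ᵥ q) := by nlinarith [mul_nonneg hcC.le hqq]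
  have hz1 : w ⬝ᵥ (A *ᵥ w) + ∑ i, x ^ a i * w i ^ 2 = 0 := by linarith
  have hz2 : x ^ b * (q ⬝ᵥ q) - q ⬝ᵥ (C *ᵥ q) = 0 := by linarith
  have hw0 : w ⬝ᵥ w = 0 := by
    by_contra hne
    have hpos : 0 < w ⬝ᵥ w := lt_of_le_of_ne hww (Ne.symm hne)
    nlinarith [mul_pos hcA hpos]
  have hq0 : q ⬝ᵥ q = 0 := by
    by_contra hne
    have hpos : 0 < q ⬝ᵥ q := lt_of_le_of_ne hqq (Ne.symm hne)
    nlinarith [mul_pos hcC hpos]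
  apply hu0
  rw [huwq, dotProduct_self_eq_zero.mp hw0, dotProduct_self_eq_zero.mp hq0]
  funext i; rcases i with i | i <;> rfl

/-- at a large scale the fast block is negative definite: `ν ≥ m`. [folklore] -/
theorem coordFamily_negIndex_ge_of_large (hA : A.IsSymm) (hC : C.IsSymm) (hb : 1 ≤ b) (x : ℝ) (hx1 : 1 ≤ x)
    (hxC : ∑ i, ∑ j, |C i j| < x) :
    m ≤ Fintype.card {j // (isHermitian_of_isSymm (coordFamily_isSymm A C B a b hA hC x)).eigenvalues j < 0} := by
  have h := card_le_negIndex (isHermitian_of_isSymm (coordFamily_isSymm A C B a b hA hC x))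
    (fun i : Fin m => Sum.elim (0 : Fin n → ℝ) (Pi.single i (1 : ℝ) : Fin m → ℝ)) ?_
  · simpa using h
  intro c hc
  have hcomb : (∑ i, c i • Sum.elim (0 : Fin n → ℝ) (Pi.single i (1 : ℝ) : Fin m → ℝ)) = Sum.elim (0 : Fin n → ℝ) c := by
    funext l
    rcases l with l | l
    · simp [Finset.sum_apply]
    · simp [Finset.sum_apply, Pi.single_apply]
  rw [hcomb, Matrix.fromBlocks_mulVec, Sum.elim_comp_inl, Sum.elim_comp_inr, Matrix.mulVec_zero, Matrix.mulVec_zero,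
    zero_add, zero_add, sumElim_dotProduct_sumElim, zero_dotProduct, zero_add, Matrix.sub_mulVec, dotProduct_sub,
    Matrix.smul_mulVec, Matrix.one_mulVec, dotProduct_smul, smul_eq_mul]
  have hbC := form_le_absSum_mul C c
  have hxb : x ≤ x ^ b := le_self_pow₀ hx1 (by omega)
  have hcc : 0 < c ⬝ᵥ c := by
    rw [dotProduct]
    obtain ⟨i, hi⟩ : ∃ i, c i ≠ 0 := by
      by_contra h; push Not at h; exact hc (funext h)
    exact lt_of_lt_of_le (mul_self_pos.mpr hi) (Finset.single_le_sum (f := fun l => c l * c l)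
      (fun l _ => mul_self_nonneg _) (Finset.mem_univ i))
  have hcoef : 0 < x ^ b - ∑ i, ∑ j, |C i j| := by linarith
  nlinarith [mul_pos hcoef hcc]

end Family

end MixedGauge

end Summit.ValiantsHypothesis.ValiantsHypothesis.Theorems.KPlusLogSqLaw
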